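import Summits.Ventures.CertifiedManyBodySolver.Certificates.HubbardSquare_nbox_edoped_tpm1o4_thermal_b3o2_PHretype3x3_j273931
import Literature.MathematicalPhysics.QuantumLattice.TypeClassSidecarReaderFillingBoxParticleHoleMu
import HarnessLib

/-!
# Ventures/CertifiedManyBodySolver — the electron-doped `β = 3 / 2` (T = 2t/3) sidecar cells (point column `(−1/4, 8)` and the NCCO object-M
# `U ≥ 8` sliver × `n ∈ [109/100, 117/100]`) with the `t′ = 0` Markov anchor READ AT THE REFLECTED CHEMICAL POTENTIAL `μ′ = 8 − μ`

HONEST FRAMING: first certified bounds; not a superconductivity verdict; every number certified or labelled float.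
WHAT THIS IS NOT: not a phase sentence; not of record until the mbsolver LEAD pen + referee sign; energy CAPS for the tree's THERMAL object
(torus limits of canonical sector Gibbs states of `hubbardTorusTT' L 1 s U` at filling `n`, ANY `Ls → ∞` — no parity condition), CONDITIONAL on
EXACTLY THE SAME hypotheses as the g9 file `HubbardSquare_nbox_edoped_tpm1o4_thermal_b3o2_PHretype3x3_j273931` (whose `edopedCell_thermal_upper_b3o2_edPoint`
/ `…_edBoxHigh` these `_mu` theorems supersede number-for-number): p2's `cert_c2sector_tp1o4_3x3_b3o2_j273931` (C2 sidecar, read on its reflected skeleton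
— the g9 retypes `c2rows_edoped_tpm1o4_n109o100/n117o100_3x3_b3o2_retype`, `c2Check_…`, `skel_…`, `sec_…`, `node_…` BY NAME, imported) and eng-2's
`t′ = 0` C1 nodes (UNCHANGED; the reflection `μ ↦ 8 − μ` is the kernel theorem `cornerCertificate_particleHole`, reader
`…_of_c2Check₂_particleHole_of_rectMarkovCertificate_particleHole_tPrimeUBox_allTori_anchorU_kinematic'`, this seat). Seat hubbard-downfold-unc-2
(pub/hubbard-downfold, MO-S1 → S2 seam, the FILLING / particle–hole direction), 2026-08-27; zero solves, zero kit.

NUMBERS (10-dp outward; the hot numerator changes by `−β_h(8 − 2μ)(n − 1)` — the Legendre step taken at `μ′ = 8 − μ` instead of the hole-tuned `μ`;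
the anchor is re-chosen among eng-2's shields since colder anchors become competitive once the Legendre loss is gone):
  POINT `(−1/4, 8) × [1.09, 1.17]`:           `e(ω) ≤ 1.1261200717`  (g9: 1.2288754256; anchor `cert_feC1_3x2_b1o4_j262363`; endpoints 0.6105920114 / 1.1261200717)
  NCCO object-M sliver `U ∈ [8, 8.67]`:       `e(ω) ≤ 1.7217210876`  (g9: 1.8042812075; anchor `cert_feC1_3x2_b1o8_j263703`)
  (the `U ≤ 8` object-M piece `…_edBoxLow` is C2-only — no C1 — and is unchanged; the object-M cell word at `β = 3 / 2` = max(edBoxLow, edBoxHigh)).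
HONEST LIMITS: as g9 — p2's sidecar is hole-doped `t′ = +1/4` read on the reflected skeleton; `t′`/`U` prices kinematic; the chord lies below the optimal
type at interior `n`; nothing is an ensemble statement. Strength = C2 ∧ C1 (hypotheses) ∧ kernel theorems; retracted with either.
[cite: LiebPRL1989, proof of Theorem 2] [cite: LiebWuPhysicaA2003, §1 eq. (3)] [cite: Israel1979, Lemma II.3.1] [cite: PoulinHastings2011, eqs. (3)–(8)] [cite: Ruelle1969, §3.3]
Generator `work/gen/gen_beta_mu.py` (seat folder; copy HOME/hubbard-downfold-unc-2/gen-g11/). Seat prover-hubbard-downfold-unc-2-g11, 2026-08-27.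
-/

noncomputable section

namespace Summit.Ventures.CertifiedManyBodySolver.Certificates

open Literature.MathematicalPhysics.QuantumLattice
open Literature.MathematicalPhysics.QuantumLattice.ThermodynamicLimit
open Literature.MathematicalPhysics.QuantumLattice.InfVolFermionState
open Literature.MathematicalPhysics.QuantumLattice.AndersonCluster
open Literature.Probability.LatticeModels
open _root_.Filter
open scoped ComplexOrder

/-- **POINT `(t′, U) = (−1/4, 8)` (M20 #20 centre column / M55 axis) × `n ∈ [109/100, 117/100]`, `β = 3 / 2` (T = 2t/3), EVERY torus, REFLECTED anchor:
`e(ω) ≤ 1.1261200717`** (endpoints 0.6105920114 / 1.1261200717; g9 direct reading 1.2288754256; C1 route: `cert_feC1_3x2_b1o4_j262363` read at `8 − μ`, `β_h = 1/4`, `σ₁ = 1/4`,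
`σ₂ = 0`). Strength = C2(cert_c2sector_tp1o4_3x3_b3o2_j273931) ∧ C1(cert_feC1_3x2_b1o4_j262363) ∧ kernel theorems. [cite: LiebPRL1989, proof of Theorem 2] [cite: LiebWuPhysicaA2003, §1 eq. (3)] [cite: Israel1979, Lemma II.3.1] [cite: PoulinHastings2011, eqs. (3)–(8)] -/
theorem edopedCell_thermal_upper_b3o2_edPoint_mu (hC2 : cert_c2sector_tp1o4_3x3_b3o2_j273931) (hC1 : cert_feC1_3x2_b1o4_j262363) {n : ℝ} (hn1 : 109 / 100 ≤ n) (hn2 : n ≤ 117 / 100)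
    {ω : InfVolFermionState 2} {Ls : ℕ → ℕ} (hLs : Tendsto Ls atTop atTop)
    (h : ω.IsTorusLimitOfMixture (sectorGibbsCount n) (fun L => sectorGibbsWeightTT' (3 / 2 : ℝ) 1 (-1 / 4) 8 n L)
      (fun L => sectorGibbsVectorTT' 1 (-1 / 4) 8 n L) Ls) :
    ω.meanEnergy (hubbardTTPrimeFermionInteraction 1 (-1 / 4) 8) 1 ≤ (1.1261200717 : ℝ) := by
  obtain ⟨k, S, hS, z, hz, O, hO, g, LB, hLB, hcert⟩ := hC1
  have hσ₁ : |(-1 / 4 : ℝ)| ≤ 1 / 4 := by norm_num [abs_of_neg]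
  have hσ₂ : |(-1 / 4 : ℝ) - (-(1 / 4))| ≤ 0 := by norm_num
  have hmain := h.meanEnergy_hubbardTTPrime_le_of_c2Check₂_particleHole_of_rectMarkovCertificate_particleHole_tPrimeUBox_allTori_anchorU_kinematic'
    (t := 1) (β := (3 / 2 : ℝ)) (by linarith) (1 / 4) hσ₁ hσ₂ 8 hLs
    (βh := (1 / 4 : ℝ)) (by norm_num) (by norm_num) (a := 3) (b := 3) (by norm_num) (by norm_num)
    c2Check_edoped_tpm1o4_n109o100_3x3_b3o2_retype c2Check_edoped_tpm1o4_n117o100_3x3_b3o2_retype skel_edoped_tpm1o4_nccoM_3x3_b3o2_retype sec_edoped_tpm1o4_nccoM_3x3_b3o2_retype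
    (ρ₁ := 109 / 100) (ρ₂ := 117 / 100) (by norm_num) (by norm_num) (by norm_num) hn1 hn2 (node_edoped_tpm1o4_n109o100_3x3_b3o2_retype hC2)
    (4741904708526519 / 2251799813685248 : ℝ) (a' := 2) (b' := 3) le_rfl (by norm_num)
    Finset.univ S hS z hz (fun i _ => hO i) g hLB hcert
  norm_num at hmain ⊢
  nlinarith [hmain, hn1, hn2]

/-- … and at every colder temperature (`β' ≥ 3 / 2`). [cite: Ruelle1969, §2.5–2.6] -/
theorem edopedCell_thermal_upper_b3o2_edPoint_mu_of_le (hC2 : cert_c2sector_tp1o4_3x3_b3o2_j273931) (hC1 : cert_feC1_3x2_b1o4_j262363) {β : ℝ} (hle : (3 / 2 : ℝ) ≤ β) {n : ℝ} (hn1 : 109 / 100 ≤ n) (hn2 : n ≤ 117 / 100)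
    {ω : InfVolFermionState 2} {Ls : ℕ → ℕ} (hLs : Tendsto Ls atTop atTop)
    (h : ω.IsTorusLimitOfMixture (sectorGibbsCount n) (fun L => sectorGibbsWeightTT' β 1 (-1 / 4) 8 n L)
      (fun L => sectorGibbsVectorTT' 1 (-1 / 4) 8 n L) Ls) :
    ω.meanEnergy (hubbardTTPrimeFermionInteraction 1 (-1 / 4) 8) 1 ≤ (1.1261200717 : ℝ) :=
  IsTorusLimitOfMixture.meanEnergy_hubbardTTPrime_le_of_forall_at_hotter_allTori (t := 1) (t' := (-1 / 4)) (U := 8) (n := n)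
    (by linarith) (by linarith) (by norm_num) hle
    (fun ω₁ Ls₁ hLs₁ h₁ => edopedCell_thermal_upper_b3o2_edPoint_mu hC2 hC1 hn1 hn2 hLs₁ h₁) hLs h

/-- **NCCO object-M `(t′, U)`-sliver `[−269/1000, −21/125] × [8, 867/100]` × `n ∈ [109/100, 117/100]`, `β = 3 / 2` (T = 2t/3), EVERY torus, REFLECTED anchor:
`e(ω) ≤ 1.7217210876`** (g9 direct reading 1.8042812075; C1 route: `cert_feC1_3x2_b1o8_j263703` read at `8 − μ`, `β_h = 1/8`, `σ₁ = 269/1000`, `σ₂ = 41/500`).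
Strength = C2(cert_c2sector_tp1o4_3x3_b3o2_j273931) ∧ C1(cert_feC1_3x2_b1o8_j263703) ∧ kernel theorems. [cite: LiebPRL1989, proof of Theorem 2] [cite: LiebWuPhysicaA2003, §1 eq. (3)] [cite: Israel1979, Lemma II.3.1] [cite: PoulinHastings2011, eqs. (3)–(8)] -/
theorem edopedCell_thermal_upper_b3o2_edBoxHigh_mu (hC2 : cert_c2sector_tp1o4_3x3_b3o2_j273931) (hC1 : cert_feC1_3x2_b1o8_j263703) {s U n : ℝ} (hs1 : -269 / 1000 ≤ s) (hs2 : s ≤ -21 / 125) (hU1 : 8 ≤ U) (hU2 : U ≤ 867 / 100) (hn1 : 109 / 100 ≤ n) (hn2 : n ≤ 117 / 100)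
    {ω : InfVolFermionState 2} {Ls : ℕ → ℕ} (hLs : Tendsto Ls atTop atTop)
    (h : ω.IsTorusLimitOfMixture (sectorGibbsCount n) (fun L => sectorGibbsWeightTT' (3 / 2 : ℝ) 1 s U n L)
      (fun L => sectorGibbsVectorTT' 1 s U n L) Ls) :
    ω.meanEnergy (hubbardTTPrimeFermionInteraction 1 s U) 1 ≤ (1.7217210876 : ℝ) := by
  obtain ⟨k, S, hS, z, hz, O, hO, g, LB, hLB, hcert⟩ := hC1
  have hσ₁ : |s| ≤ 269 / 1000 := abs_le.2 ⟨by linarith, by linarith⟩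
  have hσ₂ : |s - (-(1 / 4))| ≤ 41 / 500 := abs_le.2 ⟨by linarith, by linarith⟩
  have hmain := h.meanEnergy_hubbardTTPrime_le_of_c2Check₂_particleHole_of_rectMarkovCertificate_particleHole_tPrimeUBox_allTori_anchorU_kinematic'
    (t := 1) (β := (3 / 2 : ℝ)) (by linarith) (1 / 4) hσ₁ hσ₂ 8 hLs
    (βh := (1 / 8 : ℝ)) (by norm_num) (by norm_num) (a := 3) (b := 3) (by norm_num) (by norm_num)
    c2Check_edoped_tpm1o4_n109o100_3x3_b3o2_retype c2Check_edoped_tpm1o4_n117o100_3x3_b3o2_retype skel_edoped_tpm1o4_nccoM_3x3_b3o2_retype sec_edoped_tpm1o4_nccoM_3x3_b3o2_retype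
    (ρ₁ := 109 / 100) (ρ₂ := 117 / 100) (by norm_num) (by norm_num) (by norm_num) hn1 hn2 (node_edoped_tpm1o4_n109o100_3x3_b3o2_retype hC2)
    (5985001527430531 / 4503599627370496 : ℝ) (a' := 2) (b' := 3) le_rfl (by norm_num)
    Finset.univ S hS z hz (fun i _ => hO i) g hLB hcert
  have hM1 : max (8 - U) 0 = 0 := max_eq_right (by linarith)
  have hM2 : max (U - 8) 0 = U - 8 := max_eq_left (by linarith)
  rw [hM1, hM2] at hmain
  have hUn : (U - 8) * n ≤ 67 / 100 * n := mul_le_mul_of_nonneg_right (by linarith) (by linarith)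
  norm_num at hmain ⊢
  nlinarith [hmain, hUn, hn1, hn2, hU1, hU2]

/-- … and at every colder temperature (`β' ≥ 3 / 2`). [cite: Ruelle1969, §2.5–2.6] -/
theorem edopedCell_thermal_upper_b3o2_edBoxHigh_mu_of_le (hC2 : cert_c2sector_tp1o4_3x3_b3o2_j273931) (hC1 : cert_feC1_3x2_b1o8_j263703) {β : ℝ} (hle : (3 / 2 : ℝ) ≤ β) {s U n : ℝ} (hs1 : -269 / 1000 ≤ s) (hs2 : s ≤ -21 / 125) (hU1 : 8 ≤ U) (hU2 : U ≤ 867 / 100) (hn1 : 109 / 100 ≤ n) (hn2 : n ≤ 117 / 100)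
    {ω : InfVolFermionState 2} {Ls : ℕ → ℕ} (hLs : Tendsto Ls atTop atTop)
    (h : ω.IsTorusLimitOfMixture (sectorGibbsCount n) (fun L => sectorGibbsWeightTT' β 1 s U n L)
      (fun L => sectorGibbsVectorTT' 1 s U n L) Ls) :
    ω.meanEnergy (hubbardTTPrimeFermionInteraction 1 s U) 1 ≤ (1.7217210876 : ℝ) :=
  IsTorusLimitOfMixture.meanEnergy_hubbardTTPrime_le_of_forall_at_hotter_allTori (t := 1) (t' := s) (U := U) (n := n)
    (by linarith) (by linarith) (by norm_num) hle
    (fun ω₁ Ls₁ hLs₁ h₁ => edopedCell_thermal_upper_b3o2_edBoxHigh_mu hC2 hC1 hs1 hs2 hU1 hU2 hn1 hn2 hLs₁ h₁) hLs h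

end Summit.Ventures.CertifiedManyBodySolver.Certificates

end
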